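import Mathlib

/-!
# Solo-blind seat (MatrixMultiplication), s74 — the Weyl-group face of Conjecture AG at `n = 4`
(paper/KraftK3.md §7.15, CLAIMS c762–c770)

Background (door I1⁗ / the Kraft inequality (K₃), see `SoloBlindFibreCap`, `SoloBlindTightTwisted`).  CONJECTURE AG: for an
anisotropic quadratic map `Q : 𝔽₃ⁿ → 𝔽₃ʳ` and any affine perturbation `Q + ℓ`, every level set has `≤ 2ⁿ` points.  Geometrically a
level set is the affine part of the base locus `X ⊆ ℙⁿ` of a linear system of quadrics whose hyperplane section at infinity has NO
`𝔽₃`-point; in particular `X` contains no `𝔽₃`-rational line.  For `(n, r) = (4, 2)` and `X` smooth, `X` is a del Pezzo surface of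
degree `4`; Frobenius acts on `K_X^⊥ ≅ ℤ⁵ ⊇ D₅` through the Weyl group `W(D₅)` = signed permutations `(s, σ)` of five letters with an
even number of sign changes, the sixteen lines are the half-spin weights `½(±1,…,±1)` (even number of minus signs), a line is rational
iff its weight `ε` is fixed, i.e. `ε (σ i) = s i · ε i` for all `i`, and `#X(𝔽_q) = q² + q·(1 + tr) + 1` with `tr = Σ_{σ i = i} s i`
(Manin; Banwait–Fité–Loughran arXiv:1606.00300; Blache–Hallouin arXiv:2301.13582, Prop. 1.15; types of `W(D₅)`: Trepalin
arXiv:1803.07421, Table 4 and Thm. 3).  The purely combinatorial heart of 'smooth AG(4)' is therefore the first theorem below: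
NO FIXED WEIGHT ⟹ `tr ≤ 1`, whence `#X(𝔽₃) ≤ 9 + 3·2 + 1 = 16 = 2⁴`, with equality exactly at `tr = 1`.

The second group of theorems certifies the smallest SMOOTH tight configuration found by the exhaustive `(4,2)` census of s74
(work/tri/s74/ag4r2.c: 15390 anisotropic pairs × 3⁸ linear parts, maximum 16, 18 672 606 tight configurations, 4 583 952 of them with
smooth projective closure): the affine system `F₁ = x₁² + x₂² + x₄`, `F₂ = x₁x₃ + 2x₃² + 2x₄²` on `𝔽₃⁴` has anisotropic quadratic part,
is ONTO `𝔽₃²` (so it is not a slice of a homogeneous level set one dimension up: the regime not covered by the exact verification of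
Conjecture G at `n = 5`), and its level set at `(0, 2)` has exactly `16 = 2⁴` points.  Its projective closure is a smooth del Pezzo
surface of degree `4` (discriminant `t(t+1)(t²+1)`, five distinct roots in `ℙ¹`; checked outside the kernel) of Frobenius type
`(ab)ι_{ac}` (`#X(𝔽₉) = 100`).

Signs are encoded as `Bool` (`true` = `−1`), sign multiplication as `xor`; permutations of `Fin 5` as injective 5-tuples; all side
conditions are Boolean tests (no `Prop`-valued definitions).
Pure finite combinatorics (`decide +kernel`); no `ω` content.
-/

set_option linter.dupNamespace false
set_option autoImplicit false

namespace Summit.MatrixMultiplication.MatrixMultiplication.Theorems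

open Finset

/-- Five signs (`true` = the sign `−1`). -/
abbrev SoloBlindSign5 : Type := Bool × Bool × Bool × Bool × Bool

/-- A map `Fin 5 → Fin 5` as a 5-tuple of values. -/
abbrev SoloBlindTuple5 : Type := Fin 5 × Fin 5 × Fin 5 × Fin 5 × Fin 5

/-- Component `i` of a 5-tuple. -/
def soloBlindGet5 {α : Type} (t : α × α × α × α × α) (i : Fin 5) : α :=
  ![t.1, t.2.1, t.2.2.1, t.2.2.2.1, t.2.2.2.2] i

/-- The 5-tuple `σ` is a permutation of `Fin 5` (Boolean test). -/
def soloBlindIsPerm5 (σ : SoloBlindTuple5) : Bool :=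
  decide (∀ i j : Fin 5, soloBlindGet5 σ i = soloBlindGet5 σ j → i = j)

/-- The sign vector has an even number of `−1`'s, i.e. `(s, σ)` lies in `W(D₅) = (ℤ/2)⁴ ⋊ S₅` rather than in `W(B₅)` (Boolean test). -/
def soloBlindEvenSigns (s : SoloBlindSign5) : Bool :=
  !(s.1 ^^ s.2.1 ^^ s.2.2.1 ^^ s.2.2.2.1 ^^ s.2.2.2.2)

/-- The weight `ε = ½(±1,…,±1)` is fixed by the signed permutation `(s, σ) : v_i ↦ s_i v_{σ i}`: `ε_{σ i} = s_i ε_i` for all `i`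
(for a del Pezzo surface of degree 4: the corresponding line is defined over the ground field).  Boolean test. -/
def soloBlindFixedWeight (σ : SoloBlindTuple5) (s ε : SoloBlindSign5) : Bool :=
  decide (∀ i : Fin 5, soloBlindGet5 ε (soloBlindGet5 σ i) = (soloBlindGet5 s i ^^ soloBlindGet5 ε i))

/-- `(s, σ)` fixes SOME half-spin weight (the surface has a rational line).  Boolean test over the `2⁵` sign vectors (both parities:
the odd ones are the other half-spin orbit, i.e. the pencils of conics, and are harmlessly included). -/
def soloBlindHasFixedWeight (σ : SoloBlindTuple5) (s : SoloBlindSign5) : Bool :=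
  decide (∃ ε : SoloBlindSign5, soloBlindFixedWeight σ s ε = true)

/-- The trace of the signed permutation `(s, σ)` on `ℤ⁵`: the signed number of fixed letters. -/
def soloBlindSignedTrace (σ : SoloBlindTuple5) (s : SoloBlindSign5) : ℤ :=
  ∑ i : Fin 5, if soloBlindGet5 σ i = i then (if soloBlindGet5 s i then -1 else 1) else 0

set_option maxHeartbeats 0 in
/-- W(D₅) TRACE BOUND.  If an element `(s, σ)` of `W(D₅)` fixes no half-spin weight, its trace on `ℤ⁵` is at most `1`.
For a smooth intersection of two quadrics `X ⊆ ℙ⁴` over `𝔽_q` with no rational line this gives `#X(𝔽_q) ≤ q² + 2q + 1`,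
i.e. `≤ 16 = 2⁴` for `q = 3` (the smooth case of Conjecture AG at `n = 4`). -/
theorem soloBlind_weylD5_trace_le_one :
    ∀ σ : SoloBlindTuple5, soloBlindIsPerm5 σ = true → ∀ s : SoloBlindSign5, soloBlindEvenSigns s = true →
      soloBlindHasFixedWeight σ s = false → soloBlindSignedTrace σ s ≤ 1 := by
  decide +kernel

set_option maxHeartbeats 0 in
/-- The exact list of traces of weight-free elements of `W(D₅)`: `{-3, -2, -1, 0, 1}` (point counts `13 + 3·tr ∈ {4, 7, 10, 13, 16}`
over `𝔽₃`). -/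
theorem soloBlind_weylD5_trace_values :
    ∀ σ : SoloBlindTuple5, soloBlindIsPerm5 σ = true → ∀ s : SoloBlindSign5, soloBlindEvenSigns s = true →
      soloBlindHasFixedWeight σ s = false → soloBlindSignedTrace σ s ∈ ({-3, -2, -1, 0, 1} : Finset ℤ) := by
  decide +kernel

/-- The bound is attained: the class `(ab)ι_{ac}` (transposition `(0 1)`, signs `−1` at `0` and `2`) fixes no weight and has trace `1`. -/
theorem soloBlind_weylD5_trace_one_attained :
    soloBlindIsPerm5 (1, 0, 2, 3, 4) = true ∧ soloBlindEvenSigns (true, false, true, false, false) = true ∧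
      soloBlindHasFixedWeight (1, 0, 2, 3, 4) (true, false, true, false, false) = false ∧
        soloBlindSignedTrace (1, 0, 2, 3, 4) (true, false, true, false, false) = 1 := by
  decide +kernel

/-- Conversely a weight IS fixed as soon as every cycle is positive, e.g. for the identity with no sign change (trace `5`, the split
surface with `q² + 6q + 1` points) — recorded to show the hypothesis is not vacuous in the other direction. -/
theorem soloBlind_weylD5_identity_fixes_weight :
    soloBlindHasFixedWeight (0, 1, 2, 3, 4) (false, false, false, false, false) = true := by
  decide +kernel

/-- `𝔽₃⁴` as a nested product. -/
abbrev SoloBlindW4 : Type := ZMod 3 × ZMod 3 × ZMod 3 × ZMod 3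

/-- Quadratic part of the smooth tight configuration: `(x₁² + x₂², x₁x₃ + 2x₃² + 2x₄²)`. -/
def soloBlindDP4quad (x : SoloBlindW4) : ZMod 3 × ZMod 3 :=
  (x.1 ^ 2 + x.2.1 ^ 2, x.1 * x.2.2.1 + 2 * x.2.2.1 ^ 2 + 2 * x.2.2.2 ^ 2)

/-- The affine system `(x₁² + x₂² + x₄, x₁x₃ + 2x₃² + 2x₄²)` on `𝔽₃⁴`. -/
def soloBlindDP4aff (x : SoloBlindW4) : ZMod 3 × ZMod 3 :=
  (x.1 ^ 2 + x.2.1 ^ 2 + x.2.2.2, x.1 * x.2.2.1 + 2 * x.2.2.1 ^ 2 + 2 * x.2.2.2 ^ 2)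

set_option maxHeartbeats 0 in
/-- The quadratic part is ANISOTROPIC (no common non-trivial zero): the hyperplane section at infinity of the projective closure has
no `𝔽₃`-point. -/
theorem soloBlindDP4_anisotropic : ∀ x : SoloBlindW4, soloBlindDP4quad x = 0 → x = 0 := by
  decide +kernel

set_option maxHeartbeats 0 in
/-- The affine map is ONTO `𝔽₃²` — the regime of Conjecture AG not covered by homogenisation to Conjecture G one dimension up. -/
theorem soloBlindDP4_onto : ∀ c : ZMod 3 × ZMod 3, ∃ x : SoloBlindW4, soloBlindDP4aff x = c := by
  decide +kernel

set_option maxHeartbeats 0 in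
/-- The level set at `(0, 2)` — the affine surface `x₁² + x₂² + x₄ = 0`, `x₁x₃ + 2x₃² + 2x₄² = 2`, whose closure is a smooth del Pezzo
surface of degree four of Frobenius type `(ab)ι_{ac}` — is TIGHT: exactly `16 = 2⁴` points. -/
theorem soloBlindDP4_level_card :
    (Finset.univ.filter (fun x : SoloBlindW4 => soloBlindDP4aff x = (0, 2))).card = 16 := by
  decide +kernel

set_option maxHeartbeats 0 in
/-- … and no other level set of this affine system is larger (sizes are `≡ 1 (mod 3)`, at most `16`). -/
theorem soloBlindDP4_level_le :
    ∀ c : ZMod 3 × ZMod 3, (Finset.univ.filter (fun x : SoloBlindW4 => soloBlindDP4aff x = c)).card ≤ 16 := by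
  decide +kernel

end Summit.MatrixMultiplication.MatrixMultiplication.Theorems
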